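import Summits.CriticalPhenomena.PercolationContinuityZ3.Theses.PercReliabilityThinning
import Summits.CriticalPhenomena.PercolationContinuityZ3.Theorems.PercNearOneGluingNoHeavyLowerTailCSHTheoremOne
import Mathlib
import Literature.Probability.Percolation.CriticalContinuityProofs
import HarnessLib

/-!
# `PercReliabilityThinning.TortuosityTransfer` (stmt-CriticalPhenomena-11747) — SETTLED after continuity

Item `stmt-CriticalPhenomena-11747` of route `CriticalPhenomena/PercReliabilityThinning` (support (glue)): `ThinningPathBound → NuSupLtOne → StraightRunsRare` (the thinning/tortuosity transfer, real analysis).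

PORT of the kernel-checked composition `StraightRunsRare_of` of the line file `Cruxes/StraightRunsRare/Lines/birth.lean` (its hypotheses are the two item statements verbatim; only the `stub_*` theorems of that file carry `sorry`, and they are not copied).  p205010 is NOT used.

builds on p205010 (kernel theorem, internal audit signed; external expert review pending) — USED (`CSH.percolationContinuityZ3_holds`).  RSW3 lane, lead gen 28 (prover-prim-rsw3-lead-g28-0):
'after continuity — the ledger harvest'.
References: G. Kozma, N. Nitzan (2024), Thm. 6 / Conj. 3 [KozmaNitzan2024]; G. Grimmett, *Percolation* (1999), §8 [GrimmettPercolation1999].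
-/

noncomputable section

namespace Summit.CriticalPhenomena.PercolationContinuityZ3.Theorems

namespace PercReliabilityThinningTortuosityTransfer

open MeasureTheory Literature.Probability.Percolation Literature.Probability.LatticeModels

/-- Pure real-arithmetic kernel of the composition: from `L·t ≤ E`, `0 < F ≤ t` and `E/F = G`
conclude `L ≤ G` (for `L ≥ 0`). [folklore] -/
theorem rate_bound {L t E F G : ℝ} (hL : 0 ≤ L) (h1 : L * t ≤ E) (hF : 0 < F) (hFt : F ≤ t)
    (hEF : E / F = G) : L ≤ G := by
  rw [← hEF, le_div_iff₀ hF]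
  exact (mul_le_mul_of_nonneg_left hFt hL).trans h1

/-- `e^{-2ε} ≤ 1 - ε` for `0 ≤ ε ≤ 1/2` (from `1 + 2ε ≤ e^{2ε}` and `(1-ε)(1+2ε) ≥ 1`). [folklore] -/
theorem exp_neg_two_mul_le_one_sub {ε : ℝ} (h0 : 0 ≤ ε) (h1 : ε ≤ 1 / 2) :
    Real.exp (-(2 * ε)) ≤ 1 - ε := by
  have h := Real.add_one_le_exp (2 * ε)
  have hpos : (0 : ℝ) < 2 * ε + 1 := by linarith
  have hprod : Real.exp (-(2 * ε)) * Real.exp (2 * ε) = 1 := by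
    rw [← Real.exp_add]; simp
  have h3 : Real.exp (-(2 * ε)) ≤ 1 / (2 * ε + 1) := by
    rw [le_div_iff₀ hpos]
    calc Real.exp (-(2 * ε)) * (2 * ε + 1) ≤ Real.exp (-(2 * ε)) * Real.exp (2 * ε) :=
          mul_le_mul_of_nonneg_left h (Real.exp_pos _).le
      _ = 1 := hprod
  have h4 : 1 / (2 * ε + 1) ≤ 1 - ε := by
    rw [div_le_iff₀ hpos]
    nlinarith [mul_nonneg h0 (by linarith : (0 : ℝ) ≤ 1 - 2 * ε)]
  exact h3.trans h4



/-- **Composition** (kernel-checked, no `sorry`; hypotheses = the two stub statements verbatim,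
in the order path-survival, sharp-length): the thinning/tortuosity transfer. Concludes the crux
BY NAME. This is exactly the route's support item `TortuosityTransfer`
(stmt-CriticalPhenomena-11747: `ThinningPathBound → NuSupLtOne → StraightRunsRare`). -/
theorem StraightRunsRare_of :
    (∀ (p q : unitInterval) (x y : Fin 3 → ℤ) (L : ℕ), (Literature.Probability.Percolation.bondPercolation (Literature.Probability.LatticeModels.zdGraph 3) p).real {ω | ω ∈ Literature.Probability.Percolation.openConn x y ∧ (Literature.Probability.Percolation.openGraph ω).dist x y ≤ L} * (q : ℝ) ^ L ≤ (Literature.Probability.Percolation.bondPercolation (Literature.Probability.LatticeModels.zdGraph 3) (q * p)).real (Literature.Probability.Percolation.openConn x y)) →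
    (∃ ν' : ℝ, ν' < 1 ∧ ∃ C : ℝ, 0 < C ∧ ∃ δ₀ : ℝ, 0 < δ₀ ∧ ∀ p : unitInterval, (Literature.Probability.Percolation.criticalProbI 3 : ℝ) - δ₀ < (p : ℝ) → (p : ℝ) < Literature.Probability.Percolation.criticalProbI 3 → ∀ n : ℕ, (Literature.Probability.Percolation.bondPercolation (Literature.Probability.LatticeModels.zdGraph 3) p).real (Literature.Probability.Percolation.openConn (0 : Fin 3 → ℤ) (Pi.single 0 (n : ℤ))) ≤ Real.exp (-(((Literature.Probability.Percolation.criticalProbI 3 : ℝ) - (p : ℝ)) ^ ν' * (n : ℝ) / C))) →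
    Summit.CriticalPhenomena.PercolationContinuityZ3.Theses.PercReliabilityThinning.StraightRunsRare := by
  intro hPath hNu ρ
  obtain ⟨ν', hν', C, hC, δ₀, hδ₀, hdecay⟩ := hNu
  -- 0 < p_c(ℤ³) < 1 (Grimmett 1999 Thm (1.10), proved in tree)
  have hpc := Literature.Probability.Percolation.Grimmett1999_criticalProb_pos_lt_one_holds 3 (by norm_num)
  have hP0 : (0 : ℝ) < (criticalProbI 3 : ℝ) := hpc.1
  -- the exponent gap: the only use of ν' < 1
  have ha : 0 < 1 - ν' := by linarith
  have hK : 0 < 2 * ((ρ : ℝ) + 1) * C := by positivity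
  obtain ⟨A, hA_def⟩ : ∃ A : ℝ, A = (criticalProbI 3 : ℝ) ^ ν' / (2 * ((ρ : ℝ) + 1) * C) :=
    ⟨_, rfl⟩
  have hA : 0 < A := by rw [hA_def]; exact div_pos (Real.rpow_pos_of_pos hP0 _) hK
  -- the thinning intensity ε
  obtain ⟨ε, hε_def⟩ : ∃ ε : ℝ,
      ε = min (1 / 2) (min (δ₀ / (2 * (criticalProbI 3 : ℝ))) (A ^ (1 - ν')⁻¹ / 2)) := ⟨_, rfl⟩
  have hε0 : 0 < ε := by
    rw [hε_def]
    refine lt_min (by norm_num) (lt_min (div_pos hδ₀ (by positivity)) ?_)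
    exact div_pos (Real.rpow_pos_of_pos hA _) (by norm_num)
  have hε_half : ε ≤ 1 / 2 := by rw [hε_def]; exact min_le_left _ _
  have hε_δ : ε ≤ δ₀ / (2 * (criticalProbI 3 : ℝ)) := by
    rw [hε_def]; exact (min_le_right _ _).trans (min_le_left _ _)
  have hε_A : ε ≤ A ^ (1 - ν')⁻¹ / 2 := by
    rw [hε_def]; exact (min_le_right _ _).trans (min_le_right _ _)
  -- ε^{1-ν'} < A, hence 2(ρ+1)C·ε ≤ (ε p_c)^{ν'}
  have hεa : ε ^ (1 - ν') < A := by
    have hApos : 0 < A ^ (1 - ν')⁻¹ := Real.rpow_pos_of_pos hA _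
    have hlt : ε < A ^ (1 - ν')⁻¹ := by linarith
    calc ε ^ (1 - ν') < (A ^ (1 - ν')⁻¹) ^ (1 - ν') := Real.rpow_lt_rpow hε0.le hlt ha
      _ = A := Real.rpow_inv_rpow hA.le ha.ne'
  have hsplit : ε ^ (1 - ν') * ε ^ ν' = ε := by
    rw [← Real.rpow_add hε0]; simp
  have hKA : 2 * ((ρ : ℝ) + 1) * C * A = (criticalProbI 3 : ℝ) ^ ν' := by
    rw [hA_def]; field_simp
  have hkey : 2 * ((ρ : ℝ) + 1) * C * ε ≤ (ε * (criticalProbI 3 : ℝ)) ^ ν' := by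
    have hεν : 0 ≤ ε ^ ν' := Real.rpow_nonneg hε0.le _
    calc 2 * ((ρ : ℝ) + 1) * C * ε
        = 2 * ((ρ : ℝ) + 1) * C * (ε ^ (1 - ν') * ε ^ ν') := by rw [hsplit]
      _ ≤ 2 * ((ρ : ℝ) + 1) * C * (A * ε ^ ν') := by
          apply mul_le_mul_of_nonneg_left _ hK.le
          exact mul_le_mul_of_nonneg_right hεa.le hεν
      _ = (criticalProbI 3 : ℝ) ^ ν' * ε ^ ν' := by rw [← hKA]; ring
      _ = (ε * (criticalProbI 3 : ℝ)) ^ ν' := by rw [Real.mul_rpow hε0.le hP0.le]; ring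
  -- the rate
  have hrate : 2 * ((ρ : ℝ) + 1) * ε ≤ (ε * (criticalProbI 3 : ℝ)) ^ ν' / C := by
    rw [le_div_iff₀ hC]
    calc 2 * ((ρ : ℝ) + 1) * ε * C = 2 * ((ρ : ℝ) + 1) * C * ε := by ring
      _ ≤ _ := hkey
  have hcpos : 0 < (ε * (criticalProbI 3 : ℝ)) ^ ν' / C - 2 * (ρ : ℝ) * ε := by
    nlinarith [hrate, hε0]
  -- the thinned parameter q = 1 - ε and the level (1-ε) p_c ∈ (p_c - δ₀, p_c)
  have hq_mem : (1 - ε) ∈ unitInterval := ⟨by linarith, by linarith⟩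
  obtain ⟨q, hq_coe⟩ : ∃ q : unitInterval, (q : ℝ) = 1 - ε := ⟨⟨1 - ε, hq_mem⟩, rfl⟩
  have hp'coe : ((q * criticalProbI 3 : unitInterval) : ℝ) = (1 - ε) * (criticalProbI 3 : ℝ) := by
    rw [Set.Icc.coe_mul, hq_coe]
  have hεP : ε * (criticalProbI 3 : ℝ) ≤ δ₀ / 2 := by
    calc ε * (criticalProbI 3 : ℝ) ≤ δ₀ / (2 * (criticalProbI 3 : ℝ)) * (criticalProbI 3 : ℝ) :=
          mul_le_mul_of_nonneg_right hε_δ hP0.le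
      _ = δ₀ / 2 := by field_simp
  have hexpand : (1 - ε) * (criticalProbI 3 : ℝ) = (criticalProbI 3 : ℝ) - ε * (criticalProbI 3 : ℝ) := by
    ring
  have hlo : (criticalProbI 3 : ℝ) - δ₀ < ((q * criticalProbI 3 : unitInterval) : ℝ) := by
    rw [hp'coe, hexpand]; linarith
  have hhi : ((q * criticalProbI 3 : unitInterval) : ℝ) < (criticalProbI 3 : ℝ) := by
    rw [hp'coe, hexpand]; nlinarith [mul_pos hε0 hP0]
  have hsub : (criticalProbI 3 : ℝ) - (1 - ε) * (criticalProbI 3 : ℝ) = ε * (criticalProbI 3 : ℝ) := by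
    ring
  -- the bound, for every n (N = 0)
  refine ⟨(ε * (criticalProbI 3 : ℝ)) ^ ν' / C - 2 * (ρ : ℝ) * ε, hcpos, 0, fun n _ => ?_⟩
  have h1 := hPath (criticalProbI 3) q (0 : Fin 3 → ℤ) (Pi.single 0 (n : ℤ)) (ρ * n)
  have h2 := hdecay (q * criticalProbI 3) hlo hhi n
  rw [hp'coe, hsub] at h2
  have hmain := h1.trans h2
  -- (1 - ε)^{ρ n} ≥ e^{-2ερn}
  have hqpow : Real.exp (((ρ * n : ℕ) : ℝ) * (-(2 * ε))) ≤ (q : ℝ) ^ (ρ * n) := by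
    rw [Real.exp_nat_mul, hq_coe]
    exact pow_le_pow_left₀ (Real.exp_pos _).le (exp_neg_two_mul_le_one_sub hε0.le hε_half) _
  have hfinal : Real.exp (-((ε * (criticalProbI 3 : ℝ)) ^ ν' * (n : ℝ) / C)) /
      Real.exp (((ρ * n : ℕ) : ℝ) * (-(2 * ε))) =
      Real.exp (-(((ε * (criticalProbI 3 : ℝ)) ^ ν' / C - 2 * (ρ : ℝ) * ε) * (n : ℝ))) := by
    rw [← Real.exp_sub]
    congr 1
    push_cast
    ring
  exact rate_bound MeasureTheory.measureReal_nonneg hmain (Real.exp_pos _) hqpow hfinal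

/-- **`PercReliabilityThinning.TortuosityTransfer` (stmt-CriticalPhenomena-11747), settled.**  `fun hPath hNu => StraightRunsRare_of hPath hNu` (ported line composition).
[cite: KozmaNitzan2024, Thm. 6 with Conj. 3 (p. 15)] -/
theorem tortuosityTransfer_proof : Summit.CriticalPhenomena.PercolationContinuityZ3.Theses.PercReliabilityThinning.TortuosityTransfer := by
  intro hPath hNu
  exact StraightRunsRare_of hPath hNu

end PercReliabilityThinningTortuosityTransfer

end Summit.CriticalPhenomena.PercolationContinuityZ3.Theorems

end
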